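import Summits.HodgeConjecture.CorCM.GaloisTwentyFourDegenerateModels
import HarnessLib

/-!
# `Gal(K/ℚ) ≅ D₁₆` (dihedral of order `32`): simple degenerate CM abelian 16-folds — versus `Q₃₂`

COR-CM (cell `pub-hodgecm2`), binder seat b04 (gen 20), count-neutral claim DICYCLIC-TWO-SHEET, part XII.  The two
non-abelian groups of order `32` with a CYCLIC subgroup of index `2` on which the other coset acts by inversion are the
generalised quaternion group `Q₃₂ = Dic₈` (`x² = c`) and the dihedral group `D₁₆` (`x² = 1`); complex conjugation is
the unique central involution (`a⁸` resp. `r⁸`), neither field has an imaginary quadratic subfield.  Part IV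
(`GaloisDicyclicNondegenerate.isNondegenerate_quaternion`): for `Q₃₂` EVERY CM type is nondegenerate.  Here: for
`D₁₆` a PRIMITIVE DEGENERATE CM type exists (kernel certificate in the format of part VII,
`GaloisModels.exists_simple_degenerate_of_model_balanced`: a CM set with trivial left stabiliser, rank `9` of `17`, balanced
over a `6`-element set moved by `c`) — so simple DEGENERATE CM abelian 16-folds with exceptional Hodge classes exist.
(Seat census: `114` of `4000` sampled primitive CM sets of `D₁₆` are degenerate; for order `16`, `D₈` is good — gen 16.)
In the two-sheet determinant of part II this is the sign: `|Ŝ₁|² + |Ŝ₂|²` for `x² = c` against `|Ŝ₁|² − |Ŝ₂|²` for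
`x² = 1`.  KERNEL ONLY: theorems; no definition, no named fact, no `sorry`.  `HC_CM` is neither used nor claimed.

## References

* [Shimura1998] G. Shimura, *Abelian Varieties with Complex Multiplication and Modular Functions*, §6.2 Thm. 3,
  §8.2 Prop. 26.
* [Gordon1999HodgeAVSurvey] B. B. Gordon, *A survey of the Hodge conjecture for abelian varieties*, Thm. 6.4, §9.3.
* [Dodson1984] B. Dodson, *The structure of Galois groups of CM-fields*, Trans. AMS 283 (1984), §3.3.1 (C) (dihedral
  imprimitivity sequences).
-/

noncomputable section

open CategoryTheory CategoryTheory.Limits NumberField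
open scoped BigOperators

namespace Summit.HodgeConjecture.CorCM.GaloisModels

open Literature.NumberTheory.ComplexMultiplication
open Literature.AlgebraicGeometry.Motives (AbelianVariety CMType)
open Literature.AlgebraicGeometry.HodgeTheory
open Literature.AlgebraicGeometry.ComplexMultiplication (IsCMTypeRealisation)
open Literature.AlgebraicGeometry.Pohlmann1968
open Literature.Barriers.HodgeConjecture (divisorClassesSpan)
open Summit.HodgeConjecture.CorCM.GaloisRank

variable {K : Type} [Field K] [NumberField K] [IsCMField K] [IsGalois ℚ K]

/-- `D₁₆`: the only central involution is `r 8`. [folklore] -/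
theorem central_involution_dihedral_sixteen : ∀ x : DihedralGroup 16, x * x = 1 → x ≠ 1 →
    (∀ y : DihedralGroup 16, x * y = y * x) → x = DihedralGroup.r 8 := by
  decide

open DihedralGroup in
/-- **`Gal(K/ℚ) ≅ D₁₆` (dihedral of order `32`; complex conjugation `= r⁸`): a simple DEGENERATE abelian 16-fold with
CM by `K`**, carrying an exceptional Hodge class on some power. [cite: Shimura1998, §6.2 Thm. 3 and §8.2 Prop. 26]
[cite: Gordon1999HodgeAVSurvey, Thm. 6.4] -/
theorem exists_simple_degenerate_of_mulEquiv_dihedral_sixteen (e : (K ≃ₐ[ℚ] K) ≃* DihedralGroup 16) :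
    ∃ (Φ : CMType K) (φ₀ : K →+* ℂ) (A : AbelianVariety ℂ) (ι : 𝓞 K →+* End A)
      (θ : K →+* Module.End ℂ (complexBetti A.X 1)),
      IsPrimitive (ℂ ≃+* ℂ) Φ.1 φ₀ ∧ ¬ IsNondegenerate Φ ∧ IsCMTypeRealisation Φ A ι θ ∧ A.IsSimple ∧
      A.dim = 16 ∧
      ∃ n p : ℕ, ∃ x : complexBetti (⨁ fun _ : Fin n => A).X (2 * p), IsRationalClass x ∧
        IsOfHodgeType (⨁ fun _ : Fin n => A).dim (⨁ fun _ : Fin n => A).X (2 * p) p p x ∧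
        x ∉ divisorClassesSpan (⨁ fun _ : Fin n => A).X (⨁ fun _ : Fin n => A).dim p := by
  have hc : e ((IsCMField.complexConj K).restrictScalars ℚ) = r 8 :=
    central_involution_dihedral_sixteen _ (model_complexConj_mul_self e rfl) (model_complexConj_ne_one e rfl)
      (model_complexConj_comm e rfl)
  have h := exists_simple_degenerate_of_model_balanced e (r 8) hc
    {r 0, r 1, r 2, r 3, r 4, r 6, r 7, r 13, sr 0, sr 1, sr 2, sr 3, sr 4, sr 7, sr 13, sr 14} (by decide) (by decide)
    {r 0, r 1, r 12, sr 4, sr 5, sr 9} (by decide) (by decide)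
  rwa [DihedralGroup.card] at h

end Summit.HodgeConjecture.CorCM.GaloisModels

end
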